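import Mathlib
import Literature.AlgebraicGeometry.Tropical.InitialIdeal
import Literature.AlgebraicGeometry.Tropical.TropicalLink
import Literature.AlgebraicGeometry.Tropical.SchonIdeal
import Summits.ResolutionOfSingularities.ResolutionOfSingularities.Theorems.TropicalLinksInductiveStepRayDegenerationGen
import Summits.ResolutionOfSingularities.ResolutionOfSingularities.Theorems.TropicalLinksInductiveStepWeightZero
import Summits.ResolutionOfSingularities.ResolutionOfSingularities.Theorems.TropicalLinksInductiveStepRayFibre
import Summits.ResolutionOfSingularities.ResolutionOfSingularities.Theorems.TropicalLinksSchonResolvesRegularAlongDivisor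

/-!
# TropicalLinks / SchonResolves — the partial compactification along a coordinate ray of a schön
# very affine variety is regular (Tevelev 2007, Thm 1.4, for one-dimensional fans)

Route `ResolutionOfSingularities/TropicalLinks`, crux `SchonResolves` (stmt-ResolutionOfSingularities-17234:
"typed schön in every dimension ⇒ resolution of integral varieties over `k̄` of char `p`"), seed line
`zariski-toric-closure` (tropical compactification realised as a schematic closure and proved regular
chart by chart; see `Cruxes/SchonResolves/PICKED.md`). This file is the FIRST regularity brick of that
line, pure commutative algebra over a commutative ring `k` and an arbitrary exponent group `K`:

* `schonResolves_isLocalization_away_quotient` — for `J ⊆ k[ℤ × K] = k[x₁^±, y^±]` with contraction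
  `J_B = J ∩ k[ℕ × K]` to the partial compactification `𝔸¹ × T_K ⊇ 𝔾_m × T_K`, the torus part of the
  closure IS `V(J)`: `k[ℤ × K] ⧸ J` is the localization of `k[ℕ × K] ⧸ J_B` away from `x̄₁`
  (`schonResolves_exists_mapDomain_castProd_eq_single_mul`: denominators clear by powers of `x₁`);
* `schonResolves_mem_linkIdeal_of_single_mul_mem` — `x₁` is a non-zero-divisor modulo `J_B`;
* `schonResolves_nonempty_quotient_sup_span_ringEquiv` — the boundary `{x₁ = 0}` of the closure has
  coordinate ring `k[K] ⧸ 𝔣`, `𝔣 = (J_B + (x₁)) ∩ k[K]` (the FIBRE IDEAL of the ray dictionary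
  `tropicalLinks_nonempty_quotient_initialIdeal_fst_algEquiv`: `k[ℤ × K] ⧸ in_{e₁}(J) ≃ (k[K] ⧸ 𝔣)[ℤ]`);
* (file `TropicalLinksSchonResolvesRegularAlongDivisor.lean`) the generic lemmas
  `schonResolves_isRegularLocalRing_of_mem_of_quotient_span` (a Noetherian ring is regular at the
  primes through a non-zero-divisor `x` with `A ⧸ (x)` regular — Matsumura Thm 19.2, converse step)
  and `schonResolves_isRegularLocalRing_of_not_mem_of_away`;
* **`schonResolves_rayChart_forall_prime_regular`** — if `V(J)` is regular and the special fibre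
  `k[K] ⧸ 𝔣` is regular then the closure `Spec k[ℕ × K] ⧸ J_B` is regular;
* **`schonResolves_isSchonIdeal_rayChart_forall_prime_regular`** — hence for a SCHÖN ideal
  `I ⊆ k[ℤ^n]` over a field (`Tropical.IsSchonIdeal`) and every lattice splitting `e : ℤ^n ≃ ℤ × K`
  (every primitive ray, after a unimodular change of coordinates) the closure of `e·V(I)` in
  `𝔸¹ × T_K` is regular — via the capstone `tropicalLinks_isSchonIdeal_iff_forall_rayFibre` of the
  sister crux InductiveStep (schön ⟺ regular with regular ray fibres).

This is Tevelev's Theorem 1.4 ("schön ⇒ every tropical compactification in a smooth toric variety is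
smooth with snc boundary") restricted to the one-dimensional cones, in the Gröbner form used by the
route and without any toric-variety vocabulary; the higher-dimensional cones need in addition the
Gröbner-fan constancy of `in_w(J)` on relatively open cones (flatness of the structure map), which is
the next brick. No new definitions.

References: J. Tevelev, *Compactifications of subvarieties of tori*, Amer. J. Math. 129 (2007),
Thm 1.4 [Tevelev2007]; D. Helm, E. Katz, Canad. J. Math. 64 (2012), Lemma 3.6 / Prop 3.9
[HelmKatz2012]; H. Matsumura, *Commutative Ring Theory*, Thm 19.2 [Matsumura1987].
-/

-- single-problem summit: the doubled namespace component `ResolutionOfSingularities` is forced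
set_option linter.dupNamespace false

namespace Summit.ResolutionOfSingularities.ResolutionOfSingularities.Theorems

open AddMonoidAlgebra Literature.AlgebraicGeometry.Tropical Literature.AlgebraicGeometry.Resolution

section RayChart

variable {k : Type} [CommRing k] {K : Type} [AddCommGroup K]

/-- **Clearing denominators in `x₁`.** Every Laurent polynomial `s ∈ k[x₁^±, y^±] = k[ℤ × K]`
becomes, after multiplication by a power `x₁^d`, a polynomial in `x₁`: an element of the image of
`k[ℕ × K] = k[x₁, y^±]`. [folklore] -/
theorem schonResolves_exists_mapDomain_castProd_eq_single_mul (s : AddMonoidAlgebra k (ℤ × K)) :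
    ∃ (d : ℕ) (b : AddMonoidAlgebra k (ℕ × K)),
      mapDomain ((Nat.castAddMonoidHom ℤ).prodMap (AddMonoidHom.id K)) b =
        single (((d : ℕ) : ℤ), (0 : K)) (1 : k) * s := by
  classical
  set castP := (Nat.castAddMonoidHom ℤ).prodMap (AddMonoidHom.id K) with hcastP_def
  have hcastP : ∀ u : ℕ × K, castP u = ((u.1 : ℤ), u.2) := fun u => rfl
  have hinj : Function.Injective castP := tropicalLinks_castProd_injective
  -- a bound for the negative `x₁`-degrees of `s`
  set d : ℕ := s.coeff.support.sup fun u => (-u.1).toNat with hd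
  have hd_le : ∀ u ∈ s.coeff.support, 0 ≤ (d : ℤ) + u.1 := by
    intro u hu
    have h1 : (-u.1).toNat ≤ d := Finset.le_sup (f := fun u : ℤ × K => (-u.1).toNat) hu
    have h2 : -u.1 ≤ ((-u.1).toNat : ℤ) := Int.self_le_toNat _
    omega
  set s' : AddMonoidAlgebra k (ℤ × K) := single (((d : ℕ) : ℤ), (0 : K)) (1 : k) * s with hs'
  have hsupp : ∀ u ∈ s'.coeff.support, 0 ≤ u.1 := by
    intro u hu
    have hu' : -((d : ℤ), (0 : K)) + u ∈ s.coeff.support := by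
      rw [Finsupp.mem_support_iff] at hu ⊢
      rwa [hs', coeff_single_mul_apply, one_mul] at hu
    have := hd_le _ hu'
    simp only [Prod.neg_mk, neg_zero, Prod.fst_add] at this
    omega
  have hrange : (↑s'.coeff.support : Set (ℤ × K)) ⊆ Set.range castP := by
    intro u hu
    obtain ⟨n, hn⟩ := Int.eq_ofNat_of_zero_le (hsupp u hu)
    exact ⟨(n, u.2), by rw [hcastP]; exact Prod.ext hn.symm rfl⟩
  exact ⟨d, comapDomain castP hinj s', mapDomain_comapDomain hrange hinj⟩

/-- **`x₁` is a non-zero-divisor modulo `J ∩ k[x₁, y^±]`** (the contraction of a Laurent ideal to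
the partial compactification is saturated with respect to `x₁`, a unit upstairs). [folklore] -/
theorem schonResolves_mem_linkIdeal_of_single_mul_mem (J : Ideal (AddMonoidAlgebra k (ℤ × K)))
    {b : AddMonoidAlgebra k (ℕ × K)}
    (h : single ((1 : ℕ), (0 : K)) (1 : k) * b ∈
      linkIdeal ((Nat.castAddMonoidHom ℤ).prodMap (AddMonoidHom.id K)) J) :
    b ∈ linkIdeal ((Nat.castAddMonoidHom ℤ).prodMap (AddMonoidHom.id K)) J := by
  rw [mem_linkIdeal_iff] at h ⊢
  rw [mapDomain_mul, mapDomain_single] at h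
  exact (Ideal.unit_mul_mem_iff_mem J (isUnit_single isUnit_one _)).1 h


/-- **The torus is the principal open `{x₁ ≠ 0}` of the partial compactification, scheme-
theoretically on the closure**: for an ideal `J ⊆ k[ℤ × K]` with contraction
`J_B = J ∩ k[ℕ × K]`, the quotient `k[ℤ × K] ⧸ J` is the localization of `k[ℕ × K] ⧸ J_B` away from
(the class of) `x₁`, for any algebra structure through which `k[ℕ × K] → k[ℤ × K]` descends.
[folklore] -/
theorem schonResolves_isLocalization_away_quotient (J : Ideal (AddMonoidAlgebra k (ℤ × K)))
    [Algebra (AddMonoidAlgebra k (ℕ × K) ⧸ linkIdeal ((Nat.castAddMonoidHom ℤ).prodMap (AddMonoidHom.id K)) J) (AddMonoidAlgebra k (ℤ × K) ⧸ J)]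
    (halg : (algebraMap (AddMonoidAlgebra k (ℕ × K) ⧸ linkIdeal ((Nat.castAddMonoidHom ℤ).prodMap (AddMonoidHom.id K)) J)
        (AddMonoidAlgebra k (ℤ × K) ⧸ J)).comp (Ideal.Quotient.mk _) =
      (Ideal.Quotient.mk J).comp (mapDomainRingHom k ((Nat.castAddMonoidHom ℤ).prodMap (AddMonoidHom.id K)))) :
    IsLocalization.Away (Ideal.Quotient.mk (linkIdeal ((Nat.castAddMonoidHom ℤ).prodMap (AddMonoidHom.id K)) J) (single ((1 : ℕ), (0 : K)) (1 : k) : AddMonoidAlgebra k (ℕ × K)))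
      (AddMonoidAlgebra k (ℤ × K) ⧸ J) := by
  classical
  have halg' : ∀ b : AddMonoidAlgebra k (ℕ × K),
      algebraMap (AddMonoidAlgebra k (ℕ × K) ⧸ linkIdeal ((Nat.castAddMonoidHom ℤ).prodMap (AddMonoidHom.id K)) J) (AddMonoidAlgebra k (ℤ × K) ⧸ J)
          (Ideal.Quotient.mk (linkIdeal ((Nat.castAddMonoidHom ℤ).prodMap (AddMonoidHom.id K)) J) b) =
        Ideal.Quotient.mk J (mapDomain ((Nat.castAddMonoidHom ℤ).prodMap (AddMonoidHom.id K)) b) := fun b => DFunLike.congr_fun halg b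
  have hxmap : mapDomain ((Nat.castAddMonoidHom ℤ).prodMap (AddMonoidHom.id K)) (single ((1 : ℕ), (0 : K)) (1 : k) : AddMonoidAlgebra k (ℕ × K)) = single ((1 : ℤ), (0 : K)) (1 : k) := by
    rw [mapDomain_single]; rfl
  have hxpow : ∀ d : ℕ, mapDomain ((Nat.castAddMonoidHom ℤ).prodMap (AddMonoidHom.id K)) ((single ((1 : ℕ), (0 : K)) (1 : k) : AddMonoidAlgebra k (ℕ × K)) ^ d) = single (((d : ℕ) : ℤ), (0 : K)) (1 : k) := by
    intro d
    change mapDomainRingHom k ((Nat.castAddMonoidHom ℤ).prodMap (AddMonoidHom.id K)) ((single ((1 : ℕ), (0 : K)) (1 : k) : AddMonoidAlgebra k (ℕ × K)) ^ d) = _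
    rw [map_pow]
    change mapDomain ((Nat.castAddMonoidHom ℤ).prodMap (AddMonoidHom.id K)) (single ((1 : ℕ), (0 : K)) (1 : k) : AddMonoidAlgebra k (ℕ × K)) ^ d = _
    rw [hxmap, single_pow, one_pow]
    congr 1
    ext <;> simp
  refine
    { map_units := ?_
      surj := ?_
      exists_of_eq := ?_ }
  · rintro ⟨_, d, rfl⟩
    change IsUnit (algebraMap _ (AddMonoidAlgebra k (ℤ × K) ⧸ J)
      (Ideal.Quotient.mk (linkIdeal ((Nat.castAddMonoidHom ℤ).prodMap (AddMonoidHom.id K)) J) (single ((1 : ℕ), (0 : K)) (1 : k) : AddMonoidAlgebra k (ℕ × K)) ^ d))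
    rw [← map_pow, halg', hxpow]
    exact (isUnit_single isUnit_one _).map _
  · intro z
    obtain ⟨s, rfl⟩ := Ideal.Quotient.mk_surjective z
    obtain ⟨d, b, hb⟩ := schonResolves_exists_mapDomain_castProd_eq_single_mul s
    refine ⟨⟨Ideal.Quotient.mk (linkIdeal ((Nat.castAddMonoidHom ℤ).prodMap (AddMonoidHom.id K)) J) b,
      ⟨Ideal.Quotient.mk (linkIdeal ((Nat.castAddMonoidHom ℤ).prodMap (AddMonoidHom.id K)) J) (single ((1 : ℕ), (0 : K)) (1 : k) : AddMonoidAlgebra k (ℕ × K)) ^ d, d, rfl⟩⟩, ?_⟩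
    change Ideal.Quotient.mk J s * algebraMap _ (AddMonoidAlgebra k (ℤ × K) ⧸ J)
        (Ideal.Quotient.mk (linkIdeal ((Nat.castAddMonoidHom ℤ).prodMap (AddMonoidHom.id K)) J) (single ((1 : ℕ), (0 : K)) (1 : k) : AddMonoidAlgebra k (ℕ × K)) ^ d) =
      algebraMap _ (AddMonoidAlgebra k (ℤ × K) ⧸ J) (Ideal.Quotient.mk (linkIdeal ((Nat.castAddMonoidHom ℤ).prodMap (AddMonoidHom.id K)) J) b)
    rw [← map_pow, halg', halg', hxpow, hb, ← map_mul, mul_comm]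
  · intro a a' h
    refine ⟨1, ?_⟩
    rw [Submonoid.coe_one, one_mul, one_mul]
    obtain ⟨b, rfl⟩ := Ideal.Quotient.mk_surjective a
    obtain ⟨b', rfl⟩ := Ideal.Quotient.mk_surjective a'
    rw [halg', halg', Ideal.Quotient.eq] at h
    rw [Ideal.Quotient.eq, mem_linkIdeal_iff]
    change mapDomainRingHom k ((Nat.castAddMonoidHom ℤ).prodMap (AddMonoidHom.id K)) (b - b') ∈ J
    rw [map_sub]
    exact h

/-- **The boundary divisor `{x₁ = 0}` of the partial compactification has coordinate ring
`k[K] ⧸ 𝔣`**: for any ideal `𝔞 ⊆ k[ℕ × K] = k[x₁, y^±]`, the inclusion `k[y^±] ⊆ k[x₁, y^±]`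
induces `k[K] ⧸ (𝔞 + (x₁)) ∩ k[K] ≃+* k[ℕ × K] ⧸ (𝔞 + (x₁))` (every polynomial is congruent
modulo `x₁` to its `x₁`-degree-`0` row). [folklore] -/
theorem schonResolves_nonempty_quotient_sup_span_ringEquiv (𝔞 : Ideal (AddMonoidAlgebra k (ℕ × K))) :
    Nonempty ((AddMonoidAlgebra k K ⧸
        linkIdeal (AddMonoidHom.inr ℕ K) (𝔞 ⊔ Ideal.span {(single ((1 : ℕ), (0 : K)) (1 : k) : AddMonoidAlgebra k (ℕ × K))})) ≃+*
      (AddMonoidAlgebra k (ℕ × K) ⧸ (𝔞 ⊔ Ideal.span {(single ((1 : ℕ), (0 : K)) (1 : k) : AddMonoidAlgebra k (ℕ × K))}))) := by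
  classical
  let ψ : AddMonoidAlgebra k K →+* AddMonoidAlgebra k (ℕ × K) ⧸ (𝔞 ⊔ Ideal.span {(single ((1 : ℕ), (0 : K)) (1 : k) : AddMonoidAlgebra k (ℕ × K))}) :=
    (Ideal.Quotient.mk _).comp (mapDomainRingHom k (AddMonoidHom.inr ℕ K))
  have hψ : Function.Surjective ψ := by
    intro z
    obtain ⟨b, rfl⟩ := Ideal.Quotient.mk_surjective z
    -- split `b` into its `x₁`-degree-`0` row `DP` and the rest `EP ∈ (x₁)`
    set DP : AddMonoidAlgebra k (ℕ × K) := ofCoeff (b.coeff.filter fun u => u.1 = 0) with hDP_def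
    set EP : AddMonoidAlgebra k (ℕ × K) := ofCoeff (b.coeff.filter fun u => ¬ u.1 = 0) with hEP_def
    have hsplit : DP + EP = b := by
      apply coeff_injective
      rw [coeff_add, hDP_def, hEP_def, coeff_ofCoeff, coeff_ofCoeff, Finsupp.filter_add_filter_not]
    have hDPsupp : ∀ u ∈ DP.coeff.support, u.1 = 0 := by
      intro u hu
      rw [hDP_def, coeff_ofCoeff, Finsupp.support_filter, Finset.mem_filter] at hu
      exact hu.2
    have hEPsupp : ∀ u ∈ EP.coeff.support, u.1 ≠ 0 := by
      intro u hu
      rw [hEP_def, coeff_ofCoeff, Finsupp.support_filter, Finset.mem_filter] at hu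
      exact hu.2
    refine ⟨mapDomain (AddMonoidHom.snd ℕ K) DP, ?_⟩
    change Ideal.Quotient.mk _ (mapDomain (AddMonoidHom.inr ℕ K) (mapDomain (AddMonoidHom.snd ℕ K) DP)) = _
    rw [tropicalLinks_mapDomain_inr_mapDomain_snd_nat hDPsupp, Ideal.Quotient.eq]
    rw [show DP - b = -EP by rw [← hsplit]; abel]
    exact (Ideal.neg_mem_iff _).2
      (Ideal.mem_sup_right (tropicalLinks_mem_span_single_of_forall_fst_ne_zero hEPsupp))
  have hker : linkIdeal (AddMonoidHom.inr ℕ K) (𝔞 ⊔ Ideal.span {(single ((1 : ℕ), (0 : K)) (1 : k) : AddMonoidAlgebra k (ℕ × K))}) = RingHom.ker ψ := by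
    rw [← RingHom.comap_ker, Ideal.mk_ker]
    rfl
  exact ⟨(Ideal.quotEquivOfEq hker).trans (RingHom.quotientKerEquivOfSurjective hψ)⟩

/-- **The boundary of the closure is the special fibre**: if every localization at a prime of the
fibre ring `k[K] ⧸ 𝔣` (`𝔣` the restriction to `k[K]` of `J_B + (x₁)`, `J_B = J ∩ k[ℕ × K]`) is
regular, then so is every localization at a prime of `k[ℕ × K] ⧸ (J_B + (x₁))`. [folklore] -/
theorem schonResolves_forall_prime_regular_quotient_sup_span (J : Ideal (AddMonoidAlgebra k (ℤ × K)))
    (h : ∀ (P : Ideal (AddMonoidAlgebra k K ⧸ linkIdeal (AddMonoidHom.inr ℕ K)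
        (linkIdeal ((Nat.castAddMonoidHom ℤ).prodMap (AddMonoidHom.id K)) J ⊔ Ideal.span {(single ((1 : ℕ), (0 : K)) (1 : k) : AddMonoidAlgebra k (ℕ × K))}))) [P.IsPrime],
        IsRegularLocalRing (Localization.AtPrime P)) :
    ∀ (P : Ideal (AddMonoidAlgebra k (ℕ × K) ⧸ (linkIdeal ((Nat.castAddMonoidHom ℤ).prodMap (AddMonoidHom.id K)) J ⊔ Ideal.span {(single ((1 : ℕ), (0 : K)) (1 : k) : AddMonoidAlgebra k (ℕ × K))}))) [P.IsPrime],
      IsRegularLocalRing (Localization.AtPrime P) := by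
  obtain ⟨e₁⟩ := schonResolves_nonempty_quotient_sup_span_ringEquiv (k := k) (K := K) (linkIdeal ((Nat.castAddMonoidHom ℤ).prodMap (AddMonoidHom.id K)) J)
  exact tropicalLinks_forall_prime_regular_of_ringEquiv e₁ h

/-- **The partial compactification along a coordinate ray is regular (Tevelev's Theorem 1.4 for a
one-dimensional fan, as commutative algebra).** Let `J ⊆ k[ℤ × K] = k[x₁^±, y^±]` be an ideal with
`k[ℕ × K]` Noetherian, and let `J_B = J ∩ k[ℕ × K]` be its contraction to the partial
compactification `𝔸¹ × T_K ⊇ 𝔾_m × T_K` (so `V(J_B)` is the closure of `V(J)`). If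
(0) `V(J)` is regular — every localization of `k[ℤ × K] ⧸ J` at a prime is a regular local ring —
and (1) the special fibre `{x₁ = 0} ∩ V(J_B) = Spec k[K] ⧸ 𝔣` is regular (by the Gröbner
dictionary `tropicalLinks_nonempty_quotient_initialIdeal_fst_algEquiv` this is regularity of the
initial degeneration `in_{e₁}(J)`), then the closure `V(J_B)` is regular: every localization of
`k[ℕ × K] ⧸ J_B` at a prime is a regular local ring. Proof: off `{x₁ = 0}` the closure IS `V(J)`
(`schonResolves_isLocalization_away_quotient`); at a point of the boundary, `x₁` is a
non-zero-divisor (`schonResolves_mem_linkIdeal_of_single_mul_mem`) in the maximal ideal with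
regular quotient, so the local ring is regular (Matsumura, Thm 19.2 converse step).
[cite: Tevelev2007, Thm. 1.4] -/
theorem schonResolves_rayChart_forall_prime_regular :
    ∀ (k : Type) [CommRing k] (K : Type) [AddCommGroup K] (J : Ideal (AddMonoidAlgebra k (ℤ × K))), IsNoetherianRing (AddMonoidAlgebra k (ℕ × K)) → (∀ (P : Ideal (AddMonoidAlgebra k (ℤ × K) ⧸ J)) [P.IsPrime], IsRegularLocalRing (Localization.AtPrime P)) → (∀ (P : Ideal (AddMonoidAlgebra k K ⧸ Literature.AlgebraicGeometry.Tropical.linkIdeal (AddMonoidHom.inr ℕ K) (Literature.AlgebraicGeometry.Tropical.linkIdeal ((Nat.castAddMonoidHom ℤ).prodMap (AddMonoidHom.id K)) J ⊔ Ideal.span {AddMonoidAlgebra.single ((1 : ℕ), (0 : K)) (1 : k)}))) [P.IsPrime], IsRegularLocalRing (Localization.AtPrime P)) → ∀ (P : Ideal (AddMonoidAlgebra k (ℕ × K) ⧸ Literature.AlgebraicGeometry.Tropical.linkIdeal ((Nat.castAddMonoidHom ℤ).prodMap (AddMonoidHom.id K)) J)) [P.IsPrime], IsRegularLocalRing (Localization.AtPrime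 P) := by
  intro k _ K _ J hN h0 h1 P hP
  classical
  haveI : IsNoetherianRing (AddMonoidAlgebra k (ℕ × K)) := hN
  by_cases hx : Ideal.Quotient.mk (linkIdeal ((Nat.castAddMonoidHom ℤ).prodMap (AddMonoidHom.id K)) J) (single ((1 : ℕ), (0 : K)) (1 : k) : AddMonoidAlgebra k (ℕ × K)) ∈ P
  · -- a point of the boundary divisor: `(single ((1 : ℕ), (0 : K)) (1 : k) : AddMonoidAlgebra k (ℕ × K))` is a regular parameter
    have hreg0 : IsSMulRegular (AddMonoidAlgebra k (ℕ × K) ⧸ linkIdeal ((Nat.castAddMonoidHom ℤ).prodMap (AddMonoidHom.id K)) J)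
        (Ideal.Quotient.mk (linkIdeal ((Nat.castAddMonoidHom ℤ).prodMap (AddMonoidHom.id K)) J) (single ((1 : ℕ), (0 : K)) (1 : k) : AddMonoidAlgebra k (ℕ × K))) := by
      intro a b hab
      obtain ⟨a, rfl⟩ := Ideal.Quotient.mk_surjective a
      obtain ⟨b, rfl⟩ := Ideal.Quotient.mk_surjective b
      change Ideal.Quotient.mk _ (single ((1 : ℕ), (0 : K)) (1 : k) : AddMonoidAlgebra k (ℕ × K)) * Ideal.Quotient.mk _ a = Ideal.Quotient.mk _ (single ((1 : ℕ), (0 : K)) (1 : k) : AddMonoidAlgebra k (ℕ × K)) * Ideal.Quotient.mk _ b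
        at hab
      rw [← map_mul, ← map_mul, Ideal.Quotient.eq, ← mul_sub] at hab
      rw [Ideal.Quotient.eq]
      exact schonResolves_mem_linkIdeal_of_single_mul_mem J hab
    -- the fibre `(k[ℕ × K] ⧸ J_B) ⧸ (x̄₁) ≅ k[ℕ × K] ⧸ (J_B + (x₁)) ≅ k[K] ⧸ 𝔣` is regular
    refine schonResolves_isRegularLocalRing_of_mem_of_quotient_span _ _ hreg0 ?_ P hx
    have hmap : (Ideal.span {(single ((1 : ℕ), (0 : K)) (1 : k) : AddMonoidAlgebra k (ℕ × K))}).map (Ideal.Quotient.mk (linkIdeal ((Nat.castAddMonoidHom ℤ).prodMap (AddMonoidHom.id K)) J)) =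
        Ideal.span {Ideal.Quotient.mk (linkIdeal ((Nat.castAddMonoidHom ℤ).prodMap (AddMonoidHom.id K)) J) (single ((1 : ℕ), (0 : K)) (1 : k) : AddMonoidAlgebra k (ℕ × K))} := by
      rw [Ideal.map_span, Set.image_singleton]
    exact tropicalLinks_forall_prime_regular_of_ringEquiv
      ((DoubleQuot.quotQuotEquivQuotSup (linkIdeal ((Nat.castAddMonoidHom ℤ).prodMap (AddMonoidHom.id K)) J) (Ideal.span {(single ((1 : ℕ), (0 : K)) (1 : k) : AddMonoidAlgebra k (ℕ × K))})).symm.trans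
        (Ideal.quotEquivOfEq hmap))
      (schonResolves_forall_prime_regular_quotient_sup_span J h1)
  · -- a point of the torus: the closure is `V(J)` there
    letI alg : Algebra (AddMonoidAlgebra k (ℕ × K) ⧸ linkIdeal ((Nat.castAddMonoidHom ℤ).prodMap (AddMonoidHom.id K)) J)
        (AddMonoidAlgebra k (ℤ × K) ⧸ J) :=
      (Ideal.quotientMap J (mapDomainRingHom k ((Nat.castAddMonoidHom ℤ).prodMap (AddMonoidHom.id K))) le_rfl).toAlgebra
    have halg : (algebraMap (AddMonoidAlgebra k (ℕ × K) ⧸ linkIdeal ((Nat.castAddMonoidHom ℤ).prodMap (AddMonoidHom.id K)) J)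
        (AddMonoidAlgebra k (ℤ × K) ⧸ J)).comp (Ideal.Quotient.mk _) =
        (Ideal.Quotient.mk J).comp (mapDomainRingHom k ((Nat.castAddMonoidHom ℤ).prodMap (AddMonoidHom.id K))) :=
      RingHom.ext fun b => rfl
    haveI hloc := schonResolves_isLocalization_away_quotient J halg
    exact schonResolves_isRegularLocalRing_of_not_mem_of_away _ (AddMonoidAlgebra k (ℤ × K) ⧸ J)
      h0 P hx

end RayChart

/-- **Schön ⇒ every coordinate-ray partial compactification is regular (Tevelev 2007, Thm 1.4, for
the one-dimensional fans).** Let `I ⊆ k[ℤ^n]` be a schön ideal over a field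
(`Literature.AlgebraicGeometry.Tropical.IsSchonIdeal`: every initial degeneration
`k[ℤ^n] ⧸ in_w(I)`, `w ∈ ℤ^n`, is regular at all primes). Then for every lattice splitting
`e : ℤ^n ≃ ℤ × K` — i.e. for every primitive ray direction, after a unimodular change of
coordinates — the closure of `e · V(I)` in the partial compactification `𝔸¹ × T_K ⊇ 𝔾_m × T_K`,
the affine scheme `Spec k[ℕ × K] ⧸ (e·I ∩ k[ℕ × K])`, is regular: every localization of its
coordinate ring at a prime ideal is a regular local ring. Assembled from the ray dictionary of the
sister crux InductiveStep (`tropicalLinks_isSchonIdeal_iff_forall_rayFibre`: schön ⟺ regular with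
regular ray fibres) and `schonResolves_rayChart_forall_prime_regular`. This is the codimension-one
case of the regularity of tropical compactifications of schön varieties, the step of crux
`SchonResolves` that turns the typed schön clause into regular boundary. [cite: Tevelev2007, Thm. 1.4] -/
theorem schonResolves_isSchonIdeal_rayChart_forall_prime_regular :
    ∀ (k : Type) [Field k] (n : ℕ) (I : Ideal (AddMonoidAlgebra k (Fin n → ℤ))), Literature.AlgebraicGeometry.Tropical.IsSchonIdeal I → ∀ (K : Type) [AddCommGroup K] (e : (Fin n → ℤ) ≃+ ℤ × K) (P : Ideal (AddMonoidAlgebra k (ℕ × K) ⧸ Literature.AlgebraicGeometry.Tropical.linkIdeal ((Nat.castAddMonoidHom ℤ).prodMap (AddMonoidHom.id K)) (I.map (AddMonoidAlgebra.domCongr k k e)))) [P.IsPrime], IsRegularLocalRing (Localization.AtPrime P) := by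
  intro k _ n I hI K _ e P hP
  obtain ⟨h0, hray⟩ := (tropicalLinks_isSchonIdeal_iff_forall_rayFibre k n I).1 hI
  -- `K` is finitely generated (a quotient of `ℤ^n`), so `k[ℕ × K]` is Noetherian
  haveI : AddMonoid.FG K :=
    AddMonoid.fg_of_surjective ((AddMonoidHom.snd ℤ K).comp e.toAddMonoidHom) fun x =>
      ⟨e.symm (0, x), by simp⟩
  haveI hN : IsNoetherianRing (AddMonoidAlgebra k (ℕ × K)) := Algebra.FiniteType.isNoetherianRing k _
  -- `k[ℤ × K] ⧸ e·I ≅ k[ℤ^n] ⧸ I` is regular (schön at the weight `0`)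
  have h0' : ∀ (Q : Ideal (AddMonoidAlgebra k (ℤ × K) ⧸ I.map (AddMonoidAlgebra.domCongr k k e)))
      [Q.IsPrime], IsRegularLocalRing (Localization.AtPrime Q) :=
    tropicalLinks_forall_prime_regular_of_ringEquiv
      (Ideal.quotientEquivAlg I (I.map (AddMonoidAlgebra.domCongr k k e))
        (AddMonoidAlgebra.domCongr k k e) rfl).toRingEquiv h0
  exact schonResolves_rayChart_forall_prime_regular k K (I.map (AddMonoidAlgebra.domCongr k k e)) hN
    h0' (hray K e) P

end Summit.ResolutionOfSingularities.ResolutionOfSingularities.Theorems
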